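import Literature.NumberTheory.Automorphic.AutomorphicInductionCuspidalUnramifiedTraceIdentity
import Summits.Langlands.Langlands.Theses.QuadraticWindow
import HarnessLib

/-!
# Crux `QuadraticWindow.AutomorphicInductionUnramified` (stmt-Langlands-15138), line `Sketch`,
# stub `stub_offS_place`: the Hecke–Satake relation of the Galois orbit read off at one place

Cyclic automorphic induction (Arthur–Clozel, Ann. of Math. Stud. 120 (1989), Ch. 3) with the
Hecke–Satake relation (1.1) `(t_{π,v})^{f(w|v)} = t_{Π,w}` at EVERY unramified place.  The line
obtains, from the `S`-threaded Thm. 4.2 (e), a cuspidal `P` on `GL_N(𝔸_F)` with a Satake family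
`α` off a finite set `S` of places of `F`, Satake families `A σ` of the Galois conjugates `Q₁^σ`
(the `L²` model `CuspidalAutomorphicRepGL.galConj`) off the places of `E` over `S`, and the
relation `∑_σ A σ w = α(v)^{f(w|v)}` at every `w` outside `S`; the set `S` misses every `v`
unramified in `E` above which all conjugates are unramified (`hout`, cf.
`exists_admissible_finite`).  This file proves `stub_offS_place`: at such a place `v` and `w ∣ v`,
`α v` is an `L²` Satake parameter of `P` at `v`, and GIVEN `L²` Satake parameters `β σ` of `Q₁` at
the places `σ⁻¹ • w` satisfy `∑_σ β σ = (α v)^{f(w|v)}`.  It replaces the hypothesis `h51` of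
`automorphicInduction_cyclic_cuspidal_unramified_of_strongLifting_galOrbit_of_iff_L2'` in the
assembly of the line.

The proof is two blocks of the tree's `strongLifting_galOrbit_unramified_of_isobaricFamilies`
(`Literature/NumberTheory/Automorphic/AutomorphicInductionCuspidalUnramifiedTraceIdentity.lean`),
adapted: (1) `v ∉ S` by `hout`, transporting the parameter `β (ρ⁻¹σ)` of `Q₁` at `(ρ⁻¹σ)⁻¹ w` by
`σ` to the place `ρ w = w'` of `Q₁^σ` (`HeightOneSpectrum.exists_algEquiv_smul_eq`,
`HasSatakeParameterAt.galConj_principalCongruenceLevel`); then `α v` is read from the family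
(`IsSatakeFamilyOf`); (2) `β σ = A σ w` by independence of the level
(`HasSatakeParameterAt.eq_of_levels`), and the relation `hrel` at `w`.

References: [ArthurClozelAMS120] J. Arthur, L. Clozel, Ann. of Math. Stud. 120 (1989), Ch. 3, §1
(1.1), Thm. 4.2 (e) and its proof, pp. 203–204, 207; [BorelJacquet1979] A. Borel, H. Jacquet,
Proc. Sympos. Pure Math. 33 (1979), Part 1, §4.6 (Satake parameters at unramified places).
-/

noncomputable section

open scoped Classical
open NumberField IsDedekindDomain MeasureTheory Filter
open Literature.NumberTheory.Automorphic Literature.NumberTheory.Automorphic.AdelicGroupData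
open Literature.NumberTheory.GaloisRepresentations (HeckeCharacter)

-- `Summit.Langlands.Langlands.…` (summit = sub-problem name, D-0017 layout) trips `dupNamespace`.
set_option linter.dupNamespace false

namespace Summit.Langlands.Langlands.Theorems.AutomorphicInductionUnramified.Sketch

open scoped Pointwise in
/-- **The Hecke–Satake relation of the Galois orbit at one unramified place.**  Let `P` be
cuspidal on `GL_N(𝔸_F)` with Satake family `α` off `S`, let the conjugates `Q₁^σ` of the cuspidal
`Q₁` on `GL_n(𝔸_E)` have Satake families `A σ` off the places over `S`, with
`∑_σ A σ w = α(w ∩ F)^{f(w|v)}` at every `w` outside `S`, and let `S` miss every `v` unramified in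
`E` above which all conjugates are unramified (`hout`).  Then at a place `v` unramified in `E`,
`w ∣ v`, with given `L²` Satake parameters `β σ` of `Q₁` at the places `σ⁻¹ • w`: `v ∉ S` (the
parameter `β (ρ⁻¹σ)` transported by `σ` makes `Q₁^σ` unramified at `ρ • w`, and `Gal(E/F)` is
transitive on the places over `v`), so `α v` is a Satake parameter of `P` at `v` at some level
`K(𝔫)`, `v ∤ 𝔫 ≠ 0`; and `β σ = A σ w` (transport by `σ`, independence of the level), whence
`∑_σ β σ = (α v)^{f(w|v)}`.  Adapted from the tree's
`strongLifting_galOrbit_unramified_of_isobaricFamilies` (Steps 2 and 7 of its proof).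
[cite: ArthurClozelAMS120, Ch. 3, §1 (1.1) and Thm. 4.2 (e), proof pp. 203–204, 207] -/
theorem stub_offS_place {N n : ℕ} {F E : Type} [Field F] [NumberField F] [Field E] [NumberField E]
    [Algebra F E] [IsGalois F E]
    {μ : Measure (gl N F).automorphicQuotient} [(gl N F).IsAutomorphicMeasure μ]
    {ν : Measure (gl n E).automorphicQuotient} [(gl n E).IsAutomorphicMeasure ν]
    (hν : IsGalInvariant F ν) (P : CuspidalAutomorphicRepGL N F μ)
    (Q₁ : CuspidalAutomorphicRepGL n E ν) {S : Set (HeightOneSpectrum (𝓞 F))} {α : SatakeFamily F}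
    {A : (E ≃ₐ[F] E) → SatakeFamily E}
    (hout : ∀ v : HeightOneSpectrum (𝓞 F), Algebra.IsUnramifiedIn (𝓞 E) v.asIdeal →
      (∀ σ : E ≃ₐ[F] E, ∀ w : HeightOneSpectrum (𝓞 E), w.under (𝓞 F) = v →
        IsUnramifiedAt (Q₁.galConj F hν σ).1 w) → v ∉ S)
    (hαP : IsSatakeFamilyOf P S α)
    (hA : ∀ σ : E ≃ₐ[F] E, IsSatakeFamilyOf (Q₁.galConj F hν σ) {w | w.under (𝓞 F) ∈ S} (A σ))
    (hrel : ∀ w : HeightOneSpectrum (𝓞 E), w.under (𝓞 F) ∉ S →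
      ∑ σ : E ≃ₐ[F] E, A σ w = (α (w.under (𝓞 F))).map (· ^ w.asIdeal.inertiaDeg (𝓞 F)))
    (v : HeightOneSpectrum (𝓞 F)) (w : HeightOneSpectrum (𝓞 E))
    (hwv : w.asIdeal.under (𝓞 F) = v.asIdeal) (hvE : Algebra.IsUnramifiedIn (𝓞 E) v.asIdeal)
    (β : (E ≃ₐ[F] E) → Multiset ℂ)
    (hβ : ∀ σ : E ≃ₐ[F] E, ∃ (𝔑 : Ideal (𝓞 E)) (ϖ' : ((σ⁻¹ • w).adicCompletion E)ˣ),
      𝔑 ≠ 0 ∧ ¬ (σ⁻¹ • w).asIdeal ∣ 𝔑 ∧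
        HasSatakeParameterAt Q₁.1 (principalCongruenceLevel n E 𝔑) (σ⁻¹ • w) ϖ' (β σ)) :
    ∃ (𝔫 : Ideal (𝓞 F)) (ϖ : (v.adicCompletion F)ˣ),
      𝔫 ≠ 0 ∧ ¬ v.asIdeal ∣ 𝔫 ∧
        HasSatakeParameterAt P.1 (principalCongruenceLevel N F 𝔫) v ϖ (α v) ∧
        ∑ σ : E ≃ₐ[F] E, β σ = (α v).map (· ^ w.asIdeal.inertiaDeg (𝓞 F)) := by
  classical
  -- adapted from `Literature.NumberTheory.Automorphic.strongLifting_galOrbit_unramified_of_isobaricFamilies`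
  -- (AutomorphicInductionCuspidalUnramifiedTraceIdentity), Steps 2 and 7.
  have hwv' : w.under (𝓞 F) = v := HeightOneSpectrum.ext hwv
  /- Step 1: `v ∉ S`, since every conjugate `Q₁^σ` is unramified at every place `w'` over `v`. -/
  have hvS : v ∉ S := by
    refine hout v hvE fun σ w' hw' => ?_
    -- `w' = ρ • w` for some `ρ`; transport the parameter `β (ρ⁻¹σ)` of `Q₁` at `(ρ⁻¹σ)⁻¹ • w`
    -- by `σ` to the place `σ (ρ⁻¹σ)⁻¹ w = ρ w = w'` of the conjugate `Q₁^σ`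
    obtain ⟨ρ, hρ⟩ : ∃ ρ : E ≃ₐ[F] E, ρ • w = w' :=
      HeightOneSpectrum.exists_algEquiv_smul_eq (F := F) (E := E) (hwv'.trans hw'.symm)
    obtain ⟨𝔑, ϖ', h𝔑, hdvd, hpar⟩ := hβ (ρ⁻¹ * σ)
    have h' := hpar.galConj_principalCongruenceLevel F hν σ
    have hplace : σ • ((ρ⁻¹ * σ)⁻¹ • w) = w' := by
      rw [mul_inv_rev, inv_inv, ← hρ, smul_smul, ← mul_assoc, mul_inv_cancel, one_mul]
    have hex : ∃ (ϖ'' : ((σ • ((ρ⁻¹ * σ)⁻¹ • w)).adicCompletion E)ˣ) (γ : Multiset ℂ),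
        HasSatakeParameterAt (Q₁.1.galConj hν σ) (principalCongruenceLevel n E (σ • 𝔑))
          (σ • ((ρ⁻¹ * σ)⁻¹ • w)) ϖ'' γ := ⟨_, _, h'⟩
    rw [hplace] at hex
    obtain ⟨ϖ'', γ, h''⟩ := hex
    refine ⟨σ • 𝔑, ?_, ?_, ϖ'', γ, h''⟩
    · intro h0
      rw [Submodule.zero_eq_bot] at h0
      exact h𝔑 ((Ideal.smul_eq_bot_iff σ 𝔑).mp h0)
    · intro hd
      apply hdvd
      have key := (HeightOneSpectrum.smul_asIdeal_pow_dvd_smul_iff σ ((ρ⁻¹ * σ)⁻¹ • w) 𝔑 1).mp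
      rw [hplace, pow_one, pow_one] at key
      exact key hd
  /- Step 2: `α v` is a Satake parameter of `P` at `v`, from the family off `S`. -/
  obtain ⟨𝔫, h𝔫, hv𝔫, ϖ, hαv⟩ := hαP v hvS
  refine ⟨𝔫, ϖ, h𝔫, hv𝔫, hαv, ?_⟩
  /- Step 3: the given `β σ` are the family values `A σ w`, and the relation at `w`. -/
  have hwS : w.under (𝓞 F) ∉ S := by rwa [hwv']
  have hβA : ∀ σ : E ≃ₐ[F] E, β σ = A σ w := by
    intro σ
    obtain ⟨𝔑, ϖ', h𝔑, hdvd, hpar⟩ := hβ σ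
    have h' := hpar.galConj_principalCongruenceLevel F hν σ
    have hex : ∃ ϖ'' : ((σ • (σ⁻¹ • w)).adicCompletion E)ˣ,
        HasSatakeParameterAt (Q₁.1.galConj hν σ) (principalCongruenceLevel n E (σ • 𝔑))
          (σ • (σ⁻¹ • w)) ϖ'' (β σ) := ⟨_, h'⟩
    rw [smul_inv_smul] at hex
    obtain ⟨ϖ'', h''⟩ := hex
    have hσ𝔑 : σ • 𝔑 ≠ 0 := by
      intro h0
      rw [Submodule.zero_eq_bot] at h0
      exact h𝔑 ((Ideal.smul_eq_bot_iff σ 𝔑).mp h0)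
    have hwσ𝔑 : ¬ w.asIdeal ∣ σ • 𝔑 := by
      intro hd
      apply hdvd
      have key := (HeightOneSpectrum.smul_asIdeal_pow_dvd_smul_iff σ (σ⁻¹ • w) 𝔑 1).mp
      rw [smul_inv_smul, pow_one, pow_one] at key
      exact key hd
    obtain ⟨𝔑', h𝔑', hdvd', ϖ₃, hA'⟩ := hA σ w (by simpa only [Set.mem_setOf_eq] using hwS)
    exact HasSatakeParameterAt.eq_of_levels (Q₁.galConj F hν σ) hσ𝔑 h𝔑' hwσ𝔑 hdvd' h'' hA'
  calc ∑ σ : E ≃ₐ[F] E, β σ = ∑ σ : E ≃ₐ[F] E, A σ w := Finset.sum_congr rfl fun σ _ => hβA σ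
    _ = (α v).map (· ^ w.asIdeal.inertiaDeg (𝓞 F)) := by rw [hrel w hwS, hwv']

end Summit.Langlands.Langlands.Theorems.AutomorphicInductionUnramified.Sketch

end
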